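import Mathlib
import HarnessLib
import Summits.QuantumFields.YangMills.Theorems.HypercubicLimit.Negative.ReflectedDensity
import Summits.QuantumFields.YangMills.Theorems.FradkinShenkerFlowFiniteSusceptibilityWeakCouplingRPCauchySchwarz
import Literature.MathematicalPhysics.AQFT.OSAxiomsSchwinger
import Literature.MathematicalPhysics.QuantumLattice.LatticeScalarField
import Literature.MathematicalPhysics.QuantumFieldTheory.LatticeGaugeStaticPotentialProofs
import Literature.Probability.LatticeModels.ThermodynamicLimit

/-!
# Block E0-herm: exact lattice hermiticity of the RP-adapted plaquette family

Stub `rpBlock_hermitian` of line `conditional-mean-telescoping` (crux `stmt-QuantumFields-8646`,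
c1 seat).  The RP-adapted lattice `n`-point distribution is the finite sum
`S_n F = ∑_q ∑_{x ∈ D_q} λⁿ W_q(x) F(pt_q(x))` over plaquette strings (orientations
`q k = (i<j)`, corners `x k ∈ ℤ⁴`; temporal corners range over `box 4 L`, spatial ones over the
time slab `[1-L, L]` of the box), with REAL weights `W_q(x)` (centred torus plaquette moments in
Wilson's state on the odd torus of side `2L+1`) and plaquette CENTRES `pt_q(x)`.

Proof of `S n F = conj (S n (Θ F*))` (for every `F`, time-ordered or not):
* `conj (S n (osAdjoint F)) = ∑_{q,x} W F(θ pt ∘ rev)` since the weights are real;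
* reindex `(q, x) ↦ (q ∘ rev, x ∘ rev)` (`herm_sum_reindex_rev`) and then each corner by the corner
  reflection `R_q` (`herm_sum_reindex_corner`; temporal `y₀ ↦ -y₀` on the box, spatial
  `y₀ ↦ 1 - y₀` on the slab — both involutions, `herm_corner_mem`, `herm_corner_inv`);
* `θ (pt_q (R_q y)) = pt_q y` (`herm_point_reflect`) and the moment identity
  `W_q(R ∘ x) = W_q(x)` (`herm_moment_corner`: `torusPlaquette_timeReflect_temporal/_spatial` and
  `Θ`-invariance of the torus Wilson state, `RPCauchySchwarz.wilsonMeasure_map_timeReflect`).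
The pointwise (configuration-wise) form of the reindexing is exposed as `rpBlock_reflectSum`.
-/

noncomputable section

open scoped SchwartzMap ComplexConjugate
open MeasureTheory
open Literature.MathematicalPhysics.AQFT Literature.MathematicalPhysics.QuantumLattice
open Literature.MathematicalPhysics.QuantumFieldTheory
open Literature.Probability.LatticeModels (box Site)
open Summit.QuantumFields.YangMills.Theorems.HypercubicLimit.Negative (torusPlaquette thetaZ)

namespace Summit.QuantumFields.YangMills.Cruxes.HypercubicLimit.ConditionalMeanTelescoping

/-! ### Abstract reindexing of sums over plaquette strings -/

/-- Reindexing a sum over strings `(q, x)`, `x k ∈ D (q k)`, by reversal of the string: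
`(q, x) ↦ (q ∘ rev, x ∘ rev)`. [folklore] -/
theorem herm_sum_reindex_rev {Q A M : Type*} [Fintype Q] [AddCommMonoid M] {n : ℕ}
    (D : Q → Finset A) (Φ : (Fin n → Q) → (Fin n → A) → M) :
    ∑ q : Fin n → Q, ∑ x ∈ Fintype.piFinset (fun k => D (q k)), Φ q x =
      ∑ q : Fin n → Q, ∑ x ∈ Fintype.piFinset (fun k => D (q k)),
        Φ (q ∘ Fin.rev) (x ∘ Fin.rev) := by
  have hinv : Function.Involutive (fun q : Fin n → Q => q ∘ Fin.rev) := by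
    intro q
    funext i
    simp
  symm
  refine Fintype.sum_equiv (hinv.toPerm _) _ _ fun q => ?_
  rw [Function.Involutive.coe_toPerm]
  refine Finset.sum_nbij' (· ∘ Fin.rev) (· ∘ Fin.rev) ?_ ?_ ?_ ?_ (fun _ _ => rfl)
  · intro x hx
    rw [Fintype.mem_piFinset] at hx ⊢
    exact fun k => hx (Fin.rev k)
  · intro x hx
    rw [Fintype.mem_piFinset] at hx ⊢
    intro k
    simpa using hx (Fin.rev k)
  · intro x _
    funext k
    simp
  · intro x _
    funext k
    simp

/-- Reindexing a sum over strings `x`, `x k ∈ D (q k)`, cornerwise by involutions `R (q k)` of the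
`D (q k)`. [folklore] -/
theorem herm_sum_reindex_corner {Q A M : Type*} [AddCommMonoid M] {n : ℕ}
    (D : Q → Finset A) (R : Q → A → A) (hmem : ∀ q, ∀ y ∈ D q, R q y ∈ D q)
    (hinv : ∀ q, ∀ y ∈ D q, R q (R q y) = y) (q : Fin n → Q) (Ψ : (Fin n → A) → M) :
    ∑ x ∈ Fintype.piFinset (fun k => D (q k)), Ψ x =
      ∑ x ∈ Fintype.piFinset (fun k => D (q k)), Ψ (fun k => R (q k) (x k)) := by
  symm
  refine Finset.sum_nbij' (fun x k => R (q k) (x k)) (fun x k => R (q k) (x k)) ?_ ?_ ?_ ?_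
    (fun _ _ => rfl)
  · intro x hx
    rw [Fintype.mem_piFinset] at hx ⊢
    exact fun k => hmem _ _ (hx k)
  · intro x hx
    rw [Fintype.mem_piFinset] at hx ⊢
    exact fun k => hmem _ _ (hx k)
  · intro x hx
    rw [Fintype.mem_piFinset] at hx
    funext k
    exact hinv _ _ (hx k)
  · intro x hx
    rw [Fintype.mem_piFinset] at hx
    funext k
    exact hinv _ _ (hx k)

/-! ### The corner reflection -/

/-- The corner reflection (temporal `y ↦ θ_ℤ y - e₀`, i.e. `y₀ ↦ -y₀`; spatial `y ↦ θ_ℤ y`, i.e.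
`y₀ ↦ 1 - y₀`) preserves the corner ranges (the box, resp. its time slab `[1-L, L]`). [folklore] -/
theorem herm_corner_mem (L : ℕ) (q : {q : Fin 4 × Fin 4 // q.1 < q.2}) (y : Fin 4 → ℤ)
    (hy : y ∈ (if q.1.1 = 0 then box 4 L else (box 4 L).filter (fun y => 1 - (L : ℤ) ≤ y 0))) :
    (if q.1.1 = 0 then thetaZ y - Pi.single 0 1 else thetaZ y) ∈
      (if q.1.1 = 0 then box 4 L else (box 4 L).filter (fun y => 1 - (L : ℤ) ≤ y 0)) := by
  by_cases hq : q.1.1 = 0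
  · rw [if_pos hq] at hy
    rw [if_pos hq, if_pos hq, Literature.Probability.LatticeModels.mem_box]
    rw [Literature.Probability.LatticeModels.mem_box] at hy
    intro i
    by_cases hi : i = 0
    · subst hi
      have h0 := hy 0
      simp only [Pi.sub_apply, Theorems.HypercubicLimit.Negative.thetaZ_apply_zero, Pi.single_eq_same]
      omega
    · simpa [Pi.sub_apply, Theorems.HypercubicLimit.Negative.thetaZ_apply_of_ne y hi, hi] using hy i
  · rw [if_neg hq] at hy
    rw [if_neg hq, if_neg hq, Finset.mem_filter, Literature.Probability.LatticeModels.mem_box]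
    rw [Finset.mem_filter, Literature.Probability.LatticeModels.mem_box] at hy
    have h0 := hy.1 0
    refine ⟨fun i => ?_, ?_⟩
    · by_cases hi : i = 0
      · subst hi
        simp only [Theorems.HypercubicLimit.Negative.thetaZ_apply_zero]
        omega
      · simpa [Theorems.HypercubicLimit.Negative.thetaZ_apply_of_ne y hi] using hy.1 i
    · simp only [Theorems.HypercubicLimit.Negative.thetaZ_apply_zero]
      omega

/-- The corner reflection is an involution. [folklore] -/
theorem herm_corner_inv (q : {q : Fin 4 × Fin 4 // q.1 < q.2}) (y : Fin 4 → ℤ) :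
    (if q.1.1 = 0 then thetaZ (if q.1.1 = 0 then thetaZ y - Pi.single 0 1 else thetaZ y) - Pi.single 0 1
      else thetaZ (if q.1.1 = 0 then thetaZ y - Pi.single 0 1 else thetaZ y)) = y := by
  by_cases hq : q.1.1 = 0
  · simp only [hq, ↓reduceIte]
    funext i
    by_cases hi : i = 0
    · subst hi
      simp only [Pi.sub_apply, Theorems.HypercubicLimit.Negative.thetaZ_apply_zero, Pi.single_eq_same]
      ring
    · simp [Pi.sub_apply, Theorems.HypercubicLimit.Negative.thetaZ_apply_of_ne _ hi, hi]
  · simp only [hq, ↓reduceIte]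
    funext i
    by_cases hi : i = 0
    · subst hi
      simp only [Theorems.HypercubicLimit.Negative.thetaZ_apply_zero]
      ring
    · simp [Theorems.HypercubicLimit.Negative.thetaZ_apply_of_ne _ hi]

/-- **The reflected centre of the reflected plaquette is the centre**: `θ (pt_q (R_q y)) = pt_q y`
(time coordinate `a y₀` for temporal, `a (y₀ - 1/2)` for spatial plaquettes). [folklore] -/
theorem herm_point_reflect (a : ℝ) (q : {q : Fin 4 × Fin 4 // q.1 < q.2}) (y : Fin 4 → ℤ) :
    timeReflection 4 (a • (siteToE (if q.1.1 = 0 then thetaZ y - Pi.single 0 1 else thetaZ y) +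
        (2⁻¹ : ℝ) • (EuclideanSpace.single q.1.1 (1 : ℝ) + EuclideanSpace.single q.1.2 (1 : ℝ)
          - EuclideanSpace.single 0 (1 : ℝ)))) =
      a • (siteToE y + (2⁻¹ : ℝ) • (EuclideanSpace.single q.1.1 (1 : ℝ) +
        EuclideanSpace.single q.1.2 (1 : ℝ) - EuclideanSpace.single 0 (1 : ℝ))) := by
  have h2 : q.1.2 ≠ 0 := (lt_of_le_of_lt (Fin.zero_le _) q.2).ne'
  ext i
  rw [timeReflection_apply]
  by_cases hq : q.1.1 = 0
  · rw [if_pos hq]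
    by_cases hi : i = 0
    · subst hi
      simp only [↓reduceIte, PiLp.smul_apply, PiLp.add_apply, PiLp.sub_apply, siteToE_apply,
        Pi.sub_apply, Theorems.HypercubicLimit.Negative.thetaZ_apply_zero, Pi.single_eq_same,
        PiLp.single_apply, hq, h2.symm, smul_eq_mul]
      push_cast
      ring
    · simp only [hi, ↓reduceIte, PiLp.smul_apply, PiLp.add_apply, PiLp.sub_apply, siteToE_apply,
        Pi.sub_apply, Theorems.HypercubicLimit.Negative.thetaZ_apply_of_ne y hi,
        Pi.single_eq_of_ne hi, sub_zero]
  · rw [if_neg hq]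
    by_cases hi : i = 0
    · subst hi
      simp only [↓reduceIte, PiLp.smul_apply, PiLp.add_apply, PiLp.sub_apply, siteToE_apply,
        Theorems.HypercubicLimit.Negative.thetaZ_apply_zero,
        PiLp.single_apply, Ne.symm hq, h2.symm, smul_eq_mul]
      push_cast
      ring
    · simp only [hi, ↓reduceIte, PiLp.smul_apply, PiLp.add_apply, PiLp.sub_apply, siteToE_apply,
        Theorems.HypercubicLimit.Negative.thetaZ_apply_of_ne y hi]

/-! ### The moment identity under the corner reflection -/

section Moment

variable {G : Type} [Group G] [TopologicalSpace G] [IsTopologicalGroup G] [CompactSpace G]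
  [MeasurableSpace G] [BorelSpace G]

omit [MeasurableSpace G] [BorelSpace G] in
/-- A plaquette based at the reflected corner is the original plaquette of the reflected
configuration (`torusPlaquette_timeReflect_temporal/_spatial`). [folklore] -/
theorem herm_torusPlaquette_corner (r : LatticeRep G) (L' : ℕ) (q : {q : Fin 4 × Fin 4 // q.1 < q.2})
    (y : Fin 4 → ℤ) (U : GaugeConfig 4 L' G) :
    torusPlaquette r L' q.1.1 q.1.2 (if q.1.1 = 0 then thetaZ y - Pi.single 0 1 else thetaZ y) U =
      torusPlaquette r L' q.1.1 q.1.2 y U.timeReflect := by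
  obtain ⟨⟨i, j⟩, hij⟩ := q
  dsimp only at hij ⊢
  by_cases hi : i = 0
  · subst hi
    rw [if_pos rfl]
    exact (Theorems.HypercubicLimit.Negative.torusPlaquette_timeReflect_temporal r L' hij y U).symm
  · rw [if_neg hi]
    exact (Theorems.HypercubicLimit.Negative.torusPlaquette_timeReflect_spatial r L'
      (Nat.pos_of_ne_zero fun h => hi (Fin.ext h)) hij y U).symm

omit [MeasurableSpace G] [BorelSpace G] in
/-- **Pointwise reflection identity for RP-adapted plaquette strings** (public helper for the E2 /
E0 legs): for every configuration `U` of any torus, every `F` and every centring `m`,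
`∑_{q, x ∈ D_q} F(θ pt_q(x)) ∏ₖ (p_{q_k}(x_k)(U) - m_{q_k}) = ∑_{q, x ∈ D_q} F(pt_q(x)) ∏ₖ (p_{q_k}(x_k)(ΘU) - m_{q_k})`
— reindex each corner by the corner reflection (`herm_sum_reindex_corner`), then use
`herm_point_reflect` and `herm_torusPlaquette_corner`. [folklore] -/
theorem rpBlock_reflectSum (r : LatticeRep G) (L L' : ℕ) (a : ℝ)
    (m : {q : Fin 4 × Fin 4 // q.1 < q.2} → ℝ) {n : ℕ} (F : (Fin n → EuclideanSpace ℝ (Fin 4)) → ℂ)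
    (U : GaugeConfig 4 L' G) :
    ∑ q : Fin n → {q : Fin 4 × Fin 4 // q.1 < q.2},
      ∑ x ∈ Fintype.piFinset (fun k => if (q k).1.1 = 0 then box 4 L
          else (box 4 L).filter (fun y => 1 - (L : ℤ) ≤ y 0)),
        F (fun k => timeReflection 4 (a • (siteToE (x k) +
          (2⁻¹ : ℝ) • (EuclideanSpace.single (q k).1.1 (1 : ℝ) + EuclideanSpace.single (q k).1.2 (1 : ℝ)
            - EuclideanSpace.single 0 (1 : ℝ))))) *
          ((∏ k, (torusPlaquette r L' (q k).1.1 (q k).1.2 (x k) U - m (q k)) : ℝ) : ℂ) =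
    ∑ q : Fin n → {q : Fin 4 × Fin 4 // q.1 < q.2},
      ∑ x ∈ Fintype.piFinset (fun k => if (q k).1.1 = 0 then box 4 L
          else (box 4 L).filter (fun y => 1 - (L : ℤ) ≤ y 0)),
        F (fun k => a • (siteToE (x k) +
          (2⁻¹ : ℝ) • (EuclideanSpace.single (q k).1.1 (1 : ℝ) + EuclideanSpace.single (q k).1.2 (1 : ℝ)
            - EuclideanSpace.single 0 (1 : ℝ)))) *
          ((∏ k, (torusPlaquette r L' (q k).1.1 (q k).1.2 (x k) U.timeReflect - m (q k)) : ℝ) : ℂ) := by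
  refine Finset.sum_congr rfl fun q _ => ?_
  refine (herm_sum_reindex_corner
    (fun qq : {q : Fin 4 × Fin 4 // q.1 < q.2} =>
      if qq.1.1 = 0 then box 4 L else (box 4 L).filter (fun y => 1 - (L : ℤ) ≤ y 0))
    (fun qq y => if qq.1.1 = 0 then thetaZ y - Pi.single 0 1 else thetaZ y)
    (herm_corner_mem L) (fun qq y _ => herm_corner_inv qq y) q _).trans ?_
  refine Finset.sum_congr rfl fun x _ => ?_
  simp only [herm_point_reflect, herm_torusPlaquette_corner]

/-- **Moment identity** `W_q(R ∘ x) = W_q(x)`: the centred plaquette-string moment is invariant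
under the corner reflection (`Θ`-invariance of Wilson's torus state). [folklore] -/
theorem herm_moment_corner (r : LatticeRep G) (β : ℝ) (L : ℕ) {n : ℕ}
    (q : Fin n → {q : Fin 4 × Fin 4 // q.1 < q.2}) (m : {q : Fin 4 × Fin 4 // q.1 < q.2} → ℝ)
    (x : Fin n → (Fin 4 → ℤ)) :
    (∫ U, ∏ k, (torusPlaquette r (2 * L + 1) (q k).1.1 (q k).1.2
        (if (q k).1.1 = 0 then thetaZ (x k) - Pi.single 0 1 else thetaZ (x k)) U - m (q k))
        ∂(wilsonMeasure r.ρ β : Measure (GaugeConfig 4 (2 * L + 1) G))) =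
      ∫ U, ∏ k, (torusPlaquette r (2 * L + 1) (q k).1.1 (q k).1.2 (x k) U - m (q k))
        ∂(wilsonMeasure r.ρ β : Measure (GaugeConfig 4 (2 * L + 1) G)) := by
  simp_rw [herm_torusPlaquette_corner]
  exact Theorems.FiniteSusceptibilityWeakCoupling.RPCauchySchwarz.integral_comp_eq
    (μ := (wilsonMeasure r.ρ β : Measure (GaugeConfig 4 (2 * L + 1) G)))
    (H := fun U => ∏ k, (torusPlaquette r (2 * L + 1) (q k).1.1 (q k).1.2 (x k) U - m (q k)))
    WilsonRP.measurable_timeReflect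
    (Theorems.FiniteSusceptibilityWeakCoupling.RPCauchySchwarz.wilsonMeasure_map_timeReflect
      r.ρ r.continuous β)
    (Finset.measurable_prod _ fun k _ =>
      (Theorems.HypercubicLimit.Negative.measurable_torusPlaquette r _ _ _ _).sub measurable_const)

/-- The weight after the full reindexing `(q, x) ↦ (q ∘ rev, R ∘ x ∘ rev)` is the original weight
(`∏` is reversal invariant, then `herm_moment_corner`). [folklore] -/
theorem herm_weight (r : LatticeRep G) (β : ℝ) (L : ℕ) {n : ℕ}
    (q : Fin n → {q : Fin 4 × Fin 4 // q.1 < q.2}) (m : {q : Fin 4 × Fin 4 // q.1 < q.2} → ℝ)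
    (x : Fin n → (Fin 4 → ℤ)) :
    (∫ U, ∏ k, (torusPlaquette r (2 * L + 1) (q (Fin.rev k)).1.1 (q (Fin.rev k)).1.2
        (if (q (Fin.rev k)).1.1 = 0 then thetaZ (x (Fin.rev k)) - Pi.single 0 1
          else thetaZ (x (Fin.rev k))) U - m (q (Fin.rev k)))
        ∂(wilsonMeasure r.ρ β : Measure (GaugeConfig 4 (2 * L + 1) G))) =
      ∫ U, ∏ k, (torusPlaquette r (2 * L + 1) (q k).1.1 (q k).1.2 (x k) U - m (q k))
        ∂(wilsonMeasure r.ρ β : Measure (GaugeConfig 4 (2 * L + 1) G)) := by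
  rw [← herm_moment_corner r β L q m x]
  refine integral_congr_ae (ae_of_all _ fun U => ?_)
  exact Fintype.prod_equiv Fin.revPerm _ _ (fun k => rfl)

end Moment

/-! ### The reindexing of the lattice sum -/

/-- The full reindexing `(q, x) ↦ (q ∘ rev, R ∘ x ∘ rev)` of a sum over RP-adapted plaquette
strings. [folklore] -/
theorem herm_reindex (L : ℕ) {n : ℕ} {M : Type*} [AddCommMonoid M]
    (Φ : (Fin n → {q : Fin 4 × Fin 4 // q.1 < q.2}) → (Fin n → (Fin 4 → ℤ)) → M) :
    ∑ q : Fin n → {q : Fin 4 × Fin 4 // q.1 < q.2},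
      ∑ x ∈ Fintype.piFinset (fun k => if (q k).1.1 = 0 then box 4 L
          else (box 4 L).filter (fun y => 1 - (L : ℤ) ≤ y 0)), Φ q x =
    ∑ q : Fin n → {q : Fin 4 × Fin 4 // q.1 < q.2},
      ∑ x ∈ Fintype.piFinset (fun k => if (q k).1.1 = 0 then box 4 L
          else (box 4 L).filter (fun y => 1 - (L : ℤ) ≤ y 0)),
        Φ (q ∘ Fin.rev) (fun i => if (q (Fin.rev i)).1.1 = 0
          then thetaZ (x (Fin.rev i)) - Pi.single 0 1 else thetaZ (x (Fin.rev i))) := by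
  refine (herm_sum_reindex_rev (fun qq : {q : Fin 4 × Fin 4 // q.1 < q.2} =>
    if qq.1.1 = 0 then box 4 L else (box 4 L).filter (fun y => 1 - (L : ℤ) ≤ y 0)) Φ).trans ?_
  refine Finset.sum_congr rfl fun q _ => ?_
  exact herm_sum_reindex_corner
    (fun qq : {q : Fin 4 × Fin 4 // q.1 < q.2} =>
      if qq.1.1 = 0 then box 4 L else (box 4 L).filter (fun y => 1 - (L : ℤ) ≤ y 0))
    (fun qq y => if qq.1.1 = 0 then thetaZ y - Pi.single 0 1 else thetaZ y)
    (herm_corner_mem L) (fun qq y _ => herm_corner_inv qq y) q (fun x => Φ (q ∘ Fin.rev) (x ∘ Fin.rev))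

/-! ### Block E0-herm -/

/-- **Block E0-herm (exact lattice hermiticity of the RP-adapted family).** The RP-adapted lattice
`n`-point distributions `F ↦ λⁿ ∑_q ∑_x W_q(x) F(centres)` form a `SchwingerFamily` that is EXACTLY
hermitian in the OS sense (`S n F = conj (S n (Θ F*))` for time-ordered `F`): reindex by the corner
reflection (temporal `x₀ ↦ −x₀` on `box`, spatial `x₀ ↦ 1 − x₀` on `[1−L, L]`), use
`torusPlaquette_timeReflect_*`, `Θ`-invariance of the torus state and reality of the weights. -/
theorem rpBlock_hermitian :
    ∀ (G : Type) [Group G] [TopologicalSpace G] [IsTopologicalGroup G] [CompactSpace G]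
      [MeasurableSpace G] [BorelSpace G] (r : LatticeRep G) (β : ℝ) (L : ℕ) (a lam : ℝ)
      (m : {q : Fin 4 × Fin 4 // q.1 < q.2} → ℝ),
      (SchwingerFamily.toLabelled
        ((fun n => ∑ q : Fin n → {q : Fin 4 × Fin 4 // q.1 < q.2},
            ∑ x ∈ Fintype.piFinset (fun k => if (q k).1.1 = 0 then box 4 L
                else (box 4 L).filter (fun y => 1 - (L : ℤ) ≤ y 0)),
              (((lam ^ n * ∫ U, ∏ k, (torusPlaquette r (2 * L + 1) (q k).1.1 (q k).1.2 (x k) U - m (q k))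
                  ∂(wilsonMeasure r.ρ β : Measure (GaugeConfig 4 (2 * L + 1) G)) : ℝ) : ℂ)) •
                LabelledSchwingerFamily.evalAt (fun k => a • (siteToE (x k) +
                  (2⁻¹ : ℝ) • (EuclideanSpace.single (q k).1.1 (1 : ℝ) + EuclideanSpace.single (q k).1.2 (1 : ℝ)
                    - EuclideanSpace.single 0 (1 : ℝ))))) :
          SchwingerFamily (EuclideanSpace ℝ (Fin 4)))).IsHermitian := by
  intro G _ _ _ _ _ _ r β L a lam m n k F hF
  simp only [SchwingerFamily.toLabelled_apply, sum_apply, smul_apply,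
    LabelledSchwingerFamily.evalAt_apply, osAdjoint_apply, map_sum, smul_eq_mul, map_mul,
    Complex.conj_conj, Complex.conj_ofReal]
  symm
  rw [herm_reindex L]
  refine Finset.sum_congr rfl fun q _ => Finset.sum_congr rfl fun x _ => ?_
  simp only [Function.comp_apply, Fin.rev_rev, herm_point_reflect, herm_weight]

end Summit.QuantumFields.YangMills.Cruxes.HypercubicLimit.ConditionalMeanTelescoping

end
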